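import Literature.AlgebraicGeometry.AbelianSchemes.PDivisibleGroupBlockDocking        -- ★ (O-DOCK): `RingAction.exists_blockDocking`
import Literature.AlgebraicGeometry.GroupSchemes.BTGroupUniformizerKernelRank          -- ★ N0: `BTGroup.finrank_alg_uniformizerKernel`
import Literature.AlgebraicGeometry.GroupSchemes.CartierDualDoubleAnnihilator          -- ★ `isCommMonObj_ker`
import Literature.RingTheory.DedekindDomain.BlockIdempotentFamily                      -- ★ (O-CRT) §4: 𝒪-numerics of `Localization.AtPrime w`
import Mathlib.RingTheory.DedekindDomain.Dvr
import HarnessLib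

/-!
# The `w`-torsion layer `A[w]` of an abelian scheme with `O`-multiplication, realised with its RANK: `rk Γ(A[w]) = q²` from the block height `2ef`
# ([Tate1967] §2.2, (2.4); [HarrisTaylorAMS2001] §II.1 (p. 59); [RapoportSmithlingZhang2020Diagonal] §4.1 (p. 17))

Topic `Literature/AlgebraicGeometry/AbelianSchemes`; namespace `Literature.AlgebraicGeometry.AbelianSchemes.AbelianSchemeOver.RingAction` (continues ★ (O-DOCK)
`PDivisibleGroupBlockDocking`).  THEOREMS ONLY (no definition, no named fact, no instance, no notation, no `sorry`).  Cell `hodgecm-mathlib` (D-0151), P6 «MOD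
programme» (crux hLiu418 = stmt-HodgeConjecture-24832, `--supports`, count-neutral), half-A line L3 (socket `stub_ROOF0`, (rL-asm) `w`-block): the numeric input
**(γ) «`rk Γ(W[p]) = rk Γ(A[𝔭_w]) = q²`»** of the ONE numeric row `hcount` left in the (KW) socket (W-DOCK ED. 4 cand v3 §6.8 `WBlockLawLA3.hrk_of_layer_count`).
HONEST LABEL: HC_CM is proved only modulo the 2 remaining named inputs (hLiu418 24832, h413 24833) until rung 0 closes; this file is generic and discharges none.

THE MATHEMATICS.  `A → Spec k` an abelian scheme (commutative group law, relative dimension `g`) with a ring action `act` of a Dedekind domain `O`, `p` prime,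
`w ∋ p` maximal (residue degree `f`), `(p) = w^e·𝔟` (`e ≥ 1`, `w + 𝔟 = (1)`), a block idempotent family `a` at `w` (★ (O-CRT)), and the HEIGHT SOCKET (S-H)
«the `w`-block `Fix ε_w ⊆ A[p^∞]` has layer ranks `p^{n·2ef}`» (★ `IntegralModelSpecialPointBlockHeight.hrank_specialFibre_of_isSmoothProper` supplies it at every
special point of the P6 datum, for EVERY `w ∣ p`).  THEN the `w`-TORSION LAYER `A[w]` EXISTS AS A CLOSED FINITE COMMUTATIVE SUBGROUP `ι : G ↪ A` («a `T`-point
`t` factors through `ι` iff `ι(r) t = 1` for all `r ∈ w`», with the restricted `O`-action by homomorphisms) AND **`rk Γ(G) = p^f · p^f = q²`** — the first half of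
★ P6d `blockDocking_of_line` (★ (O-DOCK) `exists_blockDocking`: `G := Ker (β_w(ϖ) | Fix ε_w [p])`) + ★ P6b N0 `BTGroup.finrank_alg_uniformizerKernel`
(`𝒪_w`-height `2`: `(rk Ker ϖ)^e = p^{2ef}`), WITHOUT the Lie-signature socket (S-T) — so it applies to BOTH places `w`, `c•w` of the P6 datum (the dock itself
needs signature `1` and exists only at the distinguished place).

* **`exists_idealTorsionLayer_finrank_eq`** — THE HEAD.

## References
* [Tate1967] J. T. Tate, *p-divisible groups* (1967), §2 (2.1)–(2.4).
* [HarrisTaylorAMS2001] M. Harris, R. Taylor, *The geometry and cohomology of some simple Shimura varieties* (2001), §II.1 (p. 59).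
* [RapoportSmithlingZhang2020Diagonal] M. Rapoport, B. Smithling, W. Zhang, Compos. Math. 156 (2020), §4.1 (p. 17).
* [Liu2021] Y. Liu, *Fourier–Jacobi cycles and arithmetic relative trace formula* (2021), Appendix D (p. 136).
-/

set_option autoImplicit false

noncomputable section

universe u v

open CategoryTheory CategoryTheory.Limits AlgebraicGeometry MonoidalCategory CartesianMonoidalCategory
open scoped MonObj
open Literature.AlgebraicGeometry.Motives (SchemeOver)
open Literature.AlgebraicGeometry.GroupSchemes
open Literature.AlgebraicGeometry.GroupSchemes.AffineGroupScheme (Alg)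
open Literature.AlgebraicGeometry.GroupSchemes.GroupSchemeKernel (ker kerι)
open Literature.AlgebraicGeometry.GroupSchemes.BTGroup Literature.AlgebraicGeometry.GroupSchemes.BTGroup.Hom
open Literature.AlgebraicGeometry.GroupSchemes.IsRingActionBT
open Literature.RingTheory.DedekindDomain

namespace Literature.AlgebraicGeometry.AbelianSchemes.AbelianSchemeOver.RingAction

variable {k : Type u} [Field k] (p f : ℕ) [hpr : Fact p.Prime]
  {A : AbelianSchemeOver (Spec (.of k))} [IsCommMonObj A.X] {g : ℕ} (hg : A.IsOfRelDim g)
  {O : Type v} [CommRing O] [IsDedekindDomain O] (act : RingAction O A)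
  (w : Ideal O) [w.IsMaximal] (hw0 : w ≠ ⊥) (hpw : (p : O) ∈ w)
  {e : ℕ} {𝔟 : Ideal O} (he : 0 < e) (hx : Ideal.span {(p : O)} = w ^ e * 𝔟) (hcop : w ⊔ 𝔟 = ⊤)
  (a : ℕ → O) (ha1 : ∀ n, a n - 1 ∈ w ^ (e * n)) (ha2 : ∀ n, a n ∈ 𝔟 ^ n)
  -- SOCKET (S-H): the `w`-block has height `2ef`
  (hrank : ∀ n (s : Spec (.of k)),
    (((isRingActionBT_pDivisibleGroupMap act hpr.out.ne_zero hg).homOfCompatibleFamily a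
      (sub_mem_span_pow hx hcop ha1 ha2)).fixLayer n).hom.finrank s = p ^ (n * (2 * e * f)))

set_option synthInstance.maxHeartbeats 200000 in
include hw0 hpw he hrank in
/-- **THE `w`-TORSION LAYER `A[w] ↪ A` WITH ITS RANK `q²`.**  For `A → Spec k` (commutative group law, relative dimension `g`) with a ring action of the Dedekind
domain `O`, `p` prime, `w ∋ p` maximal, `(p) = w^e·𝔟` (`e ≥ 1`, `w + 𝔟 = (1)`), a block idempotent family `a` at `w` and the height socket (S-H) `hrank` (layer
ranks `p^{n·2ef}` of `Fix ε_w` — `f` is PINNED by this socket; in the datum `#(O ⧸ w) = p^f`): there is a closed commutative finite subgroup `ι : G ↪ A` whose `T`-points are exactly the points killed by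
`ι(r)`, `r ∈ w` (`G = A[w]`), carrying the restricted `O`-action `βG` by homomorphisms (`βG c ≫ ι = ι ≫ ι(c)`), with **`rk Γ(G) = p^f · p^f`**.  Assembly of ★ (O-DOCK)
`exists_blockDocking` (`G := Ker (β_w ϖ)₁`) with ★ N0 `BTGroup.finrank_alg_uniformizerKernel` (`𝒪_w`-height `2`); no Lie-signature input.
[cite: Tate1967, §2 (2.2), (2.4)] [cite: HarrisTaylorAMS2001, §II.1 (p. 59)] [cite: RapoportSmithlingZhang2020Diagonal, §4.1 (p. 17)] [cite: Liu2021, Appendix D (p. 136)] -/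
theorem exists_idealTorsionLayer_finrank_eq :
    ∃ (G : SchemeOver k) (_ : GrpObj G) (_ : IsCommMonObj G) (_ : IsAffine G.left) (_ : IsFinite G.hom) (ιA : G ⟶ A.X) (βG : O → (G ⟶ G)),
      (IsMonHom ιA ∧ IsClosedImmersion ιA.left) ∧
      (∀ ⦃T : SchemeOver k⦄ (t : T ⟶ A.X), (∀ r ∈ w, t ≫ act.i r = 1) ↔ ∃ s : T ⟶ G, s ≫ ιA = t) ∧
      (∀ c, βG c ≫ ιA = ιA ≫ act.i c) ∧ (∀ c, IsMonHom (βG c)) ∧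
      Module.finrank k (Alg G) = p ^ f * p ^ f := by
  have hp : p.Prime := hpr.out
  -- 𝒪-numerics of `𝒪 := O_w` (★ (O-CRT) §4 + Mathlib)
  haveI : IsDiscreteValuationRing (Localization.AtPrime w) :=
    IsLocalization.AtPrime.isDiscreteValuationRing_of_dedekind_domain O hw0 _
  obtain ⟨ϖ, hϖ, hpe⟩ := associated_pow_natCast w hw0 p hx hcop
  have hϖmax : IsLocalRing.maximalIdeal (Localization.AtPrime w) = Ideal.span {ϖ} := hϖ.maximalIdeal_eq
  -- ★ (O-DOCK): the block `Bw`, its `O_w`-action, `G := Ker (βw ϖ)₁` and the `A`-side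
  obtain ⟨βw, hβw, hβwR, hkill, ⟨hGc, hGaff, hGfin⟩, hker, βG, hβG, hβGmon, hιAmon, hιAci, hkerA, hβGA⟩ :=
    exists_blockDocking hp.ne_zero hg act w hx hcop a ha1 ha2 (2 * e * f) hrank he hpw ϖ hϖmax
  letI := ((((isRingActionBT_pDivisibleGroupMap act hp.ne_zero hg).homOfCompatibleFamily a
      (sub_mem_span_pow hx hcop ha1 ha2)).fixBTGroup ((isRingActionBT_pDivisibleGroupMap act hp.ne_zero hg).homOfCompatibleFamily_idem a
      (sub_mem_span_pow hx hcop ha1 ha2) (mul_self_sub_mem_span_pow hx hcop ha1 ha2)) (2 * e * f) hrank).grpObj 1)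
  haveI := (βw ϖ).isMonHom_app 1
  -- `G := Ker (βw ϖ)₁` is commutative: ★ `BTGroup.comm` + ★ `isCommMonObj_ker`
  haveI : IsCommMonObj (ker ((βw ϖ).app 1)) :=
    haveI := ((((isRingActionBT_pDivisibleGroupMap act hp.ne_zero hg).homOfCompatibleFamily a
      (sub_mem_span_pow hx hcop ha1 ha2)).fixBTGroup ((isRingActionBT_pDivisibleGroupMap act hp.ne_zero hg).homOfCompatibleFamily_idem a
      (sub_mem_span_pow hx hcop ha1 ha2) (mul_self_sub_mem_span_pow hx hcop ha1 ha2)) (2 * e * f) hrank).comm 1)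
    GroupSchemeKernel.isCommMonObj_ker ((βw ϖ).app 1)
  haveI := hGaff
  haveI := hGfin
  -- ★ N0: the `ϖ`-torsion of an `𝒪_w`-module BT group of height `2ef` has rank `q²`
  have hrkG : Module.finrank k (Alg (ker ((βw ϖ).app 1))) = p ^ f * p ^ f :=
    BTGroup.finrank_alg_uniformizerKernel _ βw ϖ hβw e f he rfl hpe (ker ((βw ϖ).app 1)) (kerι ((βw ϖ).app 1)) ⟨inferInstance, hGc⟩ hker
  exact ⟨ker ((βw ϖ).app 1), inferInstance, inferInstance, hGaff, hGfin, _, βG, ⟨hιAmon, hιAci⟩, hkerA, hβGA, hβGmon, hrkG⟩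

end Literature.AlgebraicGeometry.AbelianSchemes.AbelianSchemeOver.RingAction

end
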